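import Literature.Probability.LatticeModels.AnnulusManeuver
import HarnessLib

/-!
# A one-scale Harnack inequality for nonnegative lattice-harmonic functions on hole-free subsets of `ℤ²`

Topic `Literature/Probability/LatticeModels` (discrete potential theory on `ℤ²`, continuing the
analytic weak-Beurling toolkit `AnnulusManeuver.lean` / `ManeuverChain.lean` /
`HarmonicExtension.lean`). Written for the LERW ⟶ SLE₂ programme
(`RandomPlanarGeometry/ChordalLERWScalingLimit.lean`, whose observable is the lattice harmonic
measure of the tip, `RandomPlanarGeometry/ChordalLERWHittingProbability.lean`), where it is the
case `k = 0` ("a kind of Harnack inequality") of Lawler–Schramm–Werner's Lemma 5.2 (Ann. Probab.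
32 (2004), §5, arXiv:math/0112234 p. 27), the first of the discrete-harmonic inputs of their
hitting-probability estimate Prop. 2.2:

> "Suppose first that `|v| ≤ inrad(D)/10`. Let `W ⊂ V_D` be the set of vertices `w` satisfying
> `h(w) ≥ h(v)`. Then `W` contains a path from `v` to `∂D`. But the probability `p` that the path
> traced by simple random walk from `0` before exiting `D` separates `v` from `∂D` is bounded away
> from `0`. On that event, the simple random walk hits `W` before exiting `D`. Consequently
> `h(0) ≥ p h(v)`, as needed."

Here the random walk is replaced, exactly as in the tree's proof of the weak Beurling estimate,
by the analytic maneuver of `AnnulusManeuver.lean`: `maneuverConst_le_killedIn` says that the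
solution of the Dirichlet problem "killed on `Sᶜ` before leaving the box of radius `48k`" is at
least the universal constant `maneuverConst = c_* > 0` on the box of radius `12k`, as soon as
`S ⊆ K` for a hole-free `K` missing a site of the small box; and the maximum principle
(`harmExt_le_of_superharmonic`) compares `h` with `h(v)/2` times that solution. The hole-free set
is `K = {w ∈ U : h(w) ≤ h(v)/2}`: a site outside it is outside `U` (and escapes to infinity
because `U` is hole-free) or carries a value `> h(v)/2`, whence a lattice walk along which
`h > h(v)/2` leads out of `U` (`exists_walk_pos_of_harmonic_pos`, the tree's substitute for
"`W` contains a path from `v` to `∂D`").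

* **`harnack_one_scale`** — let `U ⊆ ℤ²` be finite and hole-free (`HoleFree U`: every site
  outside `U` is joined to sites of arbitrarily large ordinate by lattice steps outside `U` — the
  lattice form of "simply connected"), `h` lattice harmonic on `U` and nonnegative on `U` and its
  outer boundary, and let the box of radius `48k` about `v` lie in `U` (`k ≥ 1`). Then
  `h(x) ≥ (c_*/2) h(v)` for every `x` in the box of radius `12k` about `v`.

Iterating along chains of such boxes gives Harnack inequalities between any two points joined
inside `U` at bounded hyperbolic distance (LSW's use of Koebe distortion along `ψ_D⁻¹[0, z_ℓ]`);
that chaining is left to the consumer.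

## References

* G. F. Lawler, O. Schramm, W. Werner, Ann. Probab. 32 (2004) 939–995, Lemma 5.2 (case `k = 0`)
  and its proof [LawlerSchrammWerner2004].
* G. F. Lawler, V. Limic, *Random Walk: A Modern Introduction* (2010), Thm. 6.3.9 (discrete Harnack
  inequality) [LawlerLimic2010].
-/

noncomputable section

namespace Literature.Probability.LatticeModels

open Set SimpleGraph

/-! ### Lattice walks outside a set give chains of `FaceStep`s -/

/-- A lattice walk all of whose sites lie outside `P` is a chain of steps avoiding `P`.
[folklore] -/
theorem reflTransGen_faceStep_of_walk {P : Set (Site 2)} {u v : Site 2} (p : (zdGraph 2).Walk u v)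
    (hp : ∀ z ∈ p.support, z ∉ P) : Relation.ReflTransGen (FaceStep P) u v := by
  induction p with
  | nil => exact Relation.ReflTransGen.refl
  | cons hadj q ih =>
    rename_i a b c
    rw [Walk.support_cons] at hp
    have ha : a ∉ P := hp a (List.mem_cons_self)
    have hq : ∀ z ∈ q.support, z ∉ P := fun z hz => hp z (List.mem_cons_of_mem _ hz)
    have hb : b ∉ P := hq b (Walk.start_mem_support q)
    exact Relation.ReflTransGen.head ⟨hadj, ha, hb⟩ (ih hq)

/-! ### The sub-level set below half the value at `v` is hole-free -/

/-- Subtracting a constant keeps a function lattice harmonic. [folklore] -/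
theorem IsLatticeHarmonicOn.sub_const {h : Site 2 → ℝ} {U : Set (Site 2)}
    (hh : IsLatticeHarmonicOn h U) (C : ℝ) : IsLatticeHarmonicOn (fun w => h w - C) U := by
  intro w hw
  have := hh w hw
  simp only [latticeLaplacian] at this ⊢
  simpa using this

/-- **The set `K = {w ∈ U : h w ≤ m}` is hole-free** when `U` is finite and hole-free and `h` is
lattice harmonic on `U`: a site outside `K` is outside `U`, or inside `U` with `h > m`, in which
case a lattice walk along which `h > m` leads out of `U` (support propagation for `h - m`), and
from outside `U` one escapes to infinity avoiding `U ⊇ K`. (LSW04, proof of Lemma 5.2: "`W`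
contains a path from `v` to `∂D`".) [cite: LawlerSchrammWerner2004, Lemma 5.2 (proof)] -/
theorem holeFree_sublevel {U : Set (Site 2)} (hU : U.Finite) (hUh : HoleFree U) {h : Site 2 → ℝ}
    (hh : IsLatticeHarmonicOn h U) (m : ℝ) : HoleFree {w | w ∈ U ∧ h w ≤ m} := by
  set K : Set (Site 2) := {w | w ∈ U ∧ h w ≤ m} with hK
  have hKU : K ⊆ U := fun w hw => hw.1
  intro g hg M
  -- from outside `U`, escape by hole-freeness of `U`
  have escape : ∀ w, w ∉ U → ∃ g', M ≤ g' 1 ∧ Relation.ReflTransGen (FaceStep K) w g' := by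
    intro w hw
    obtain ⟨g', hg', hpath⟩ := hUh w hw M
    exact ⟨g', hg', Relation.ReflTransGen.mono (fun a b (hs : FaceStep U a b) => hs.mono hKU) _ _ hpath⟩
  by_cases hgU : g ∈ U
  · -- `h g > m`: follow a walk with `h > m` out of `U`
    have hgm : m < h g := by
      by_contra hle
      exact hg ⟨hgU, not_lt.1 hle⟩
    obtain ⟨w, hwU, -, p, hp⟩ :=
      exists_walk_pos_of_harmonic_pos hU (hh.sub_const m) hgU (sub_pos.2 hgm)
    have hpK : ∀ z ∈ p.support, z ∉ K := by
      intro z hz hzK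
      have := (hp z hz).1
      exact absurd hzK.2 (not_le.2 (sub_pos.1 this))
    obtain ⟨g', hg', hpath⟩ := escape w hwU
    exact ⟨g', hg', (reflTransGen_faceStep_of_walk p hpK).trans hpath⟩
  · exact escape g hgU

/-! ### The one-scale Harnack inequality -/

/-- **One-scale Harnack inequality** (Lawler–Schramm–Werner 2004, Lemma 5.2, case `k = 0`;
Lawler–Limic 2010, Thm. 6.3.9): for a finite hole-free `U ⊆ ℤ²`, a function `h` lattice harmonic
on `U` and nonnegative on `U` and on its outer boundary, and a site `v` whose box of radius `48k`
(`mW v k`, `k ≥ 1`) lies in `U`, every `x` in the box of radius `12k` about `v` (`mB v k`) satisfies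
`(maneuverConst/2) · h v ≤ h x`. Proof: with `K = {w ∈ U : h w ≤ h(v)/2}` (hole-free,
`holeFree_sublevel`, and `v ∉ K` when `h v > 0`), `maneuverConst ≤ killedIn K (mW v k) x`
(`maneuverConst_le_killedIn`), while `(h(v)/2) · killedIn K (mW v k) ≤ h` on `K ∩ mW v k` by the
maximum principle (`harmExt_le_of_superharmonic`: on the outer boundary the data are `0 ≤ h`
outside the box and `1 < h/(h(v)/2)` on box sites outside `K`). [cite: LawlerSchrammWerner2004, Lemma 5.2] -/
theorem harnack_one_scale {U : Set (Site 2)} (hU : U.Finite) (hUh : HoleFree U) {h : Site 2 → ℝ}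
    (hh : IsLatticeHarmonicOn h U) (hpos : ∀ w ∈ U ∪ latticeOuterBoundary U, 0 ≤ h w)
    {v : Site 2} {k : ℕ} (hk : 0 < k) (hvU : mW v k ⊆ U) {x : Site 2} (hx : x ∈ mB v k) :
    maneuverConst / 2 * h v ≤ h x := by
  have hvmem : v ∈ U := hvU (mB_subset_mW (by simp [mB]))
  have hxU : x ∈ U := hvU (mB_subset_mW hx)
  have hc1 := maneuverConst_le_one
  have hc0 := maneuverConst_pos
  -- trivial when `h v ≤ 0` (then `h v = 0`)
  rcases le_or_gt (h v) 0 with hv0 | hv0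
  · have : h v = 0 := le_antisymm hv0 (hpos v (Or.inl hvmem))
    rw [this, mul_zero]
    exact hpos x (Or.inl hxU)
  set m : ℝ := h v / 2 with hm
  have hm0 : 0 < m := by positivity
  set K : Set (Site 2) := {w | w ∈ U ∧ h w ≤ m} with hK
  have hKhole : HoleFree K := holeFree_sublevel hU hUh hh m
  have hvK : v ∉ K := fun hvK' => by
    have := hvK'.2
    rw [hm] at this
    linarith
  -- the maneuver bound
  have hkill : maneuverConst ≤ killedIn K (mW v k) x :=
    maneuverConst_le_killedIn hKhole subset_rfl hk hvK (by simp [mB]) hx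
  -- trivial when `x ∉ K` (then `h x > m ≥ (c_*/2) h v`)
  by_cases hxK : x ∈ K
  swap
  · have hxm : m < h x := by
      by_contra hle
      exact hxK ⟨hxU, not_lt.1 hle⟩
    calc maneuverConst / 2 * h v = maneuverConst * m := by rw [hm]; ring
      _ ≤ 1 * m := by gcongr
      _ ≤ h x := by rw [one_mul]; exact hxm.le
  -- maximum principle on `K ∩ mW v k`: `killedIn ≤ h / m`
  have hfin : (K ∩ mW v k).Finite := (mW_finite v k).subset inter_subset_right
  have hsuper : IsLatticeSuperharmonicOn (fun w => m⁻¹ * h w) (K ∩ mW v k) := by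
    intro w hw
    rw [latticeLaplacian_const_mul, hh w hw.1.1, mul_zero]
  have hcomp : killedIn K (mW v k) x ≤ m⁻¹ * h x := by
    refine harmExt_le_of_superharmonic hfin hsuper (fun w hw => ?_) ⟨hxK, mB_subset_mW hx⟩
    -- boundary data: `1` on box sites outside `K`, `0` outside the box
    have hwout : w ∉ K ∩ mW v k := hw.1
    by_cases hwW : w ∈ mW v k
    · rw [if_pos hwW]
      have hwU : w ∈ U := hvU hwW
      have hwK : w ∉ K := fun hwK => hwout ⟨hwK, hwW⟩
      have hwm : m < h w := by
        by_contra hle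
        exact hwK ⟨hwU, not_lt.1 hle⟩
      rw [← div_eq_inv_mul, le_div_iff₀ hm0, one_mul]
      exact hwm.le
    · rw [if_neg hwW]
      have hwpos : 0 ≤ h w := by
        -- `w` is a lattice neighbour of a site of `K ∩ mW ⊆ U`: in `U` or on its outer boundary
        obtain ⟨-, u, hu, j, rfl⟩ := hw
        exact hpos _ (add_cornerUnit_mem_union hu.1.1 j)
      positivity
  -- assemble
  have key : maneuverConst ≤ m⁻¹ * h x := hkill.trans hcomp
  rw [← div_eq_inv_mul, le_div_iff₀ hm0] at key
  calc maneuverConst / 2 * h v = maneuverConst * m := by rw [hm]; ring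
    _ ≤ h x := key

end Literature.Probability.LatticeModels
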